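import Summits.NavierStokesRegularity.FunctionalMining.VelocityL6NonlinearPoincare
import Summits.NavierStokesRegularity.FunctionalMining.VelocityL4Interpolation
import HarnessLib

/-!
# FunctionalMining — `L¹⁰`/`L¹⁸` interpolation of a zero-mean field by `U₆ = ∫|u|⁶` and
# `I₆ = ∫|u|⁴|∇u|²` (static inputs of the `L⁶` velocity-moment law, K0 row `EV.s=6|T_LD|G1`)

search for candidate a priori estimates; no regularity claim. Cell `pub-nsfunc`, prove seat
(gen 8). Static functional inequalities for a smooth zero-mean vector field `u` on the flat torus;
nothing here concerns Navier–Stokes solutions. Notation: `U₆ := ∫‖u‖⁶`, `I₆ := ∫‖u‖⁴∑ₖ‖∂ₖu‖²`,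
`J := ∫‖u‖²∑ₖ‖∂ₖu‖²`, `Z := gradNormSq u`, `A_m := ∫‖u‖^m`.

* `integral_norm_pow_ten_pow_three_le` — `A₁₀³ ≤ U₆² A₁₈` (three Cauchy–Schwarz steps; SIEVELD
  §3.5's `‖u‖₁₀⁵ ≤ ‖u‖₆²‖u‖₁₈³` in polynomial form).
* `integral_weighted_sq_le` — `J² ≤ I₆ Z` (Cauchy–Schwarz).
* `integral_norm_pow_eighteen_le` — `A₁₈ ≤ 32(729C₆ + (39420d³)³) I₆³` given a mean-zero Sobolev
  constant `C₆` (Sobolev on the smooth regularisation `(‖u‖²+ε)u` minus its mean, `ε → 0`, and the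
  nonlinear Poincaré inequality `U₆ ≤ 39420d³ I₆` of `VelocityL6NonlinearPoincare`).
[ours; elementary given the tree's Sobolev embedding]
-/

noncomputable section

open MeasureTheory Finset
open scoped InnerProductSpace RealInnerProductSpace ContDiff

namespace Summit.NavierStokesRegularity.FunctionalMining

open Literature.Analysis.FunctionSpaces Literature.Analysis.FunctionSpaces.Torus

namespace VelocityL6

variable {d : Type*} [Fintype d] [DecidableEq d]

/-! ## 1. Cauchy–Schwarz interpolations -/

omit [DecidableEq d] in
/-- Generic Cauchy–Schwarz step `(∫‖u‖^{a+b})² ≤ (∫‖u‖^{2a})(∫‖u‖^{2b})`. [folklore] -/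
theorem integral_norm_pow_add_sq_le {u : UnitAddTorus d → EuclideanSpace ℝ d} (hu : Continuous u)
    (a b : ℕ) :
    (∫ x, ‖u x‖ ^ (a + b)) ^ 2 ≤ (∫ x, ‖u x‖ ^ (2 * a)) * ∫ x, ‖u x‖ ^ (2 * b) := by
  have hca : Continuous fun x => ‖u x‖ ^ a := hu.norm.pow a
  have hcb : Continuous fun x => ‖u x‖ ^ b := hu.norm.pow b
  have h := integral_mul_le_sqrt_mul_sqrt hca hcb
  have e1 : ∫ x, ‖u x‖ ^ a * ‖u x‖ ^ b = ∫ x, ‖u x‖ ^ (a + b) :=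
    integral_congr_ae (ae_of_all _ fun x => by ring)
  have e2 : ∫ x, (‖u x‖ ^ a) ^ 2 = ∫ x, ‖u x‖ ^ (2 * a) :=
    integral_congr_ae (ae_of_all _ fun x => by ring)
  have e3 : ∫ x, (‖u x‖ ^ b) ^ 2 = ∫ x, ‖u x‖ ^ (2 * b) :=
    integral_congr_ae (ae_of_all _ fun x => by ring)
  rw [e1, e2, e3] at h
  have hA : 0 ≤ ∫ x, ‖u x‖ ^ (2 * a) := integral_nonneg fun x => by positivity
  have hB : 0 ≤ ∫ x, ‖u x‖ ^ (2 * b) := integral_nonneg fun x => by positivity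
  have hS : 0 ≤ ∫ x, ‖u x‖ ^ (a + b) := integral_nonneg fun x => by positivity
  calc (∫ x, ‖u x‖ ^ (a + b)) ^ 2
      ≤ (Real.sqrt (∫ x, ‖u x‖ ^ (2 * a)) * Real.sqrt (∫ x, ‖u x‖ ^ (2 * b))) ^ 2 :=
        pow_le_pow_left₀ hS h 2
    _ = (∫ x, ‖u x‖ ^ (2 * a)) * ∫ x, ‖u x‖ ^ (2 * b) := by
        rw [mul_pow, Real.sq_sqrt hA, Real.sq_sqrt hB]

omit [DecidableEq d] in
/-- `A₁₀³ ≤ U₆² A₁₈`: `(∫‖u‖¹⁰)³ ≤ (∫‖u‖⁶)² ∫‖u‖¹⁸` (three Cauchy–Schwarz steps: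
`A₁₀² ≤ A₈A₁₂`, `A₈² ≤ U₆A₁₀`, `A₁₂² ≤ U₆A₁₈`). [folklore] -/
theorem integral_norm_pow_ten_pow_three_le {u : UnitAddTorus d → EuclideanSpace ℝ d}
    (hu : Continuous u) :
    (∫ x, ‖u x‖ ^ 10) ^ 3 ≤ (∫ x, ‖u x‖ ^ 6) ^ 2 * ∫ x, ‖u x‖ ^ 18 := by
  obtain ⟨A6, h6⟩ : ∃ A : ℝ, A = ∫ x, ‖u x‖ ^ 6 := ⟨_, rfl⟩
  obtain ⟨A8, h8⟩ : ∃ A : ℝ, A = ∫ x, ‖u x‖ ^ 8 := ⟨_, rfl⟩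
  obtain ⟨A10, h10⟩ : ∃ A : ℝ, A = ∫ x, ‖u x‖ ^ 10 := ⟨_, rfl⟩
  obtain ⟨A12, h12⟩ : ∃ A : ℝ, A = ∫ x, ‖u x‖ ^ 12 := ⟨_, rfl⟩
  obtain ⟨A18, h18⟩ : ∃ A : ℝ, A = ∫ x, ‖u x‖ ^ 18 := ⟨_, rfl⟩
  rw [← h6, ← h10, ← h18]
  have hA6 : 0 ≤ A6 := by rw [h6]; exact integral_nonneg fun x => by positivity
  have hA8 : 0 ≤ A8 := by rw [h8]; exact integral_nonneg fun x => by positivity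
  have hA10 : 0 ≤ A10 := by rw [h10]; exact integral_nonneg fun x => by positivity
  have hA12 : 0 ≤ A12 := by rw [h12]; exact integral_nonneg fun x => by positivity
  have hA18 : 0 ≤ A18 := by rw [h18]; exact integral_nonneg fun x => by positivity
  have c1 : A10 ^ 2 ≤ A8 * A12 := by
    rw [h10, h8, h12]; exact integral_norm_pow_add_sq_le hu 4 6
  have c2 : A8 ^ 2 ≤ A6 * A10 := by
    rw [h8, h6, h10]; exact integral_norm_pow_add_sq_le hu 3 5
  have c3 : A12 ^ 2 ≤ A6 * A18 := by
    rw [h12, h6, h18]; exact integral_norm_pow_add_sq_le hu 3 9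
  -- `A10⁴ ≤ A8²A12² ≤ (A6 A10)(A6 A18)`
  have h4 : A10 ^ 4 ≤ (A6 * A10) * (A6 * A18) := by
    calc A10 ^ 4 = (A10 ^ 2) ^ 2 := by ring
      _ ≤ (A8 * A12) ^ 2 := pow_le_pow_left₀ (sq_nonneg _) c1 2
      _ = A8 ^ 2 * A12 ^ 2 := by ring
      _ ≤ (A6 * A10) * (A6 * A18) := mul_le_mul c2 c3 (sq_nonneg _) (by positivity)
  rcases hA10.eq_or_lt with hz | hpos
  · rw [← hz]; simp; positivity
  · have : A10 ^ 3 * A10 ≤ (A6 ^ 2 * A18) * A10 := by nlinarith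
    exact le_of_mul_le_mul_right this hpos

/-- `J² ≤ I₆ Z`: `(∫‖u‖²∑ₖ‖∂ₖu‖²)² ≤ (∫‖u‖⁴∑ₖ‖∂ₖu‖²)(∫∑ₖ‖∂ₖu‖²)` (Cauchy–Schwarz with the
weight `∑ₖ‖∂ₖu‖²`). [folklore] -/
theorem integral_weighted_sq_le {u : UnitAddTorus d → EuclideanSpace ℝ d} (hu : IsSmooth u) :
    (∫ x, ‖u x‖ ^ 2 * ∑ k, ‖partialDeriv k u x‖ ^ 2) ^ 2 ≤
      (∫ x, ‖u x‖ ^ 4 * ∑ k, ‖partialDeriv k u x‖ ^ 2) * gradNormSq u := by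
  have hs : Continuous fun x => ∑ k, ‖partialDeriv k u x‖ ^ 2 :=
    continuous_finsetSum _ fun k _ => (hu.partialDeriv k).continuous.norm.pow 2
  have hs0 : ∀ x, 0 ≤ ∑ k, ‖partialDeriv k u x‖ ^ 2 := fun x =>
    Finset.sum_nonneg fun k _ => sq_nonneg _
  have hsq : Continuous fun x => Real.sqrt (∑ k, ‖partialDeriv k u x‖ ^ 2) :=
    Real.continuous_sqrt.comp hs
  have hf : Continuous fun x => ‖u x‖ ^ 2 * Real.sqrt (∑ k, ‖partialDeriv k u x‖ ^ 2) :=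
    (hu.continuous.norm.pow 2).mul hsq
  have h := integral_mul_le_sqrt_mul_sqrt hf hsq
  have e1 : ∫ x, ‖u x‖ ^ 2 * Real.sqrt (∑ k, ‖partialDeriv k u x‖ ^ 2) *
      Real.sqrt (∑ k, ‖partialDeriv k u x‖ ^ 2) = ∫ x, ‖u x‖ ^ 2 * ∑ k, ‖partialDeriv k u x‖ ^ 2 :=
    integral_congr_ae (ae_of_all _ fun x => by
      dsimp only
      rw [mul_assoc, Real.mul_self_sqrt (hs0 x)])
  have e2 : ∫ x, (‖u x‖ ^ 2 * Real.sqrt (∑ k, ‖partialDeriv k u x‖ ^ 2)) ^ 2 =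
      ∫ x, ‖u x‖ ^ 4 * ∑ k, ‖partialDeriv k u x‖ ^ 2 :=
    integral_congr_ae (ae_of_all _ fun x => by
      dsimp only
      rw [mul_pow, Real.sq_sqrt (hs0 x)]; ring)
  have e3 : ∫ x, Real.sqrt (∑ k, ‖partialDeriv k u x‖ ^ 2) ^ 2 = gradNormSq u := by
    unfold gradNormSq
    exact integral_congr_ae (ae_of_all _ fun x => Real.sq_sqrt (hs0 x))
  rw [e1, e2, e3] at h
  have hI : 0 ≤ ∫ x, ‖u x‖ ^ 4 * ∑ k, ‖partialDeriv k u x‖ ^ 2 :=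
    integral_nonneg fun x => by positivity
  have hZ : 0 ≤ gradNormSq u := gradNormSq_nonneg u
  have hJ : 0 ≤ ∫ x, ‖u x‖ ^ 2 * ∑ k, ‖partialDeriv k u x‖ ^ 2 :=
    integral_nonneg fun x => by positivity
  calc (∫ x, ‖u x‖ ^ 2 * ∑ k, ‖partialDeriv k u x‖ ^ 2) ^ 2
      ≤ (Real.sqrt (∫ x, ‖u x‖ ^ 4 * ∑ k, ‖partialDeriv k u x‖ ^ 2) *
          Real.sqrt (gradNormSq u)) ^ 2 := pow_le_pow_left₀ hJ h 2
    _ = (∫ x, ‖u x‖ ^ 4 * ∑ k, ‖partialDeriv k u x‖ ^ 2) * gradNormSq u := by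
        rw [mul_pow, Real.sq_sqrt hI, Real.sq_sqrt hZ]

/-! ## 2. `A₁₈ ≤ C I₆³` through the regularisation `(‖u‖² + ε)u` -/

/-- `(a + b)⁶ ≤ 32 (a⁶ + b⁶)`. [folklore] -/
private theorem add_pow_six_le' (a b : ℝ) : (a + b) ^ 6 ≤ 32 * (a ^ 6 + b ^ 6) := by
  have h1 : (a + b) ^ 2 ≤ 2 * (a ^ 2 + b ^ 2) := by nlinarith [sq_nonneg (a - b)]
  have h2 : ∀ {p q : ℝ}, 0 ≤ p → 0 ≤ q → (p + q) ^ 3 ≤ 4 * (p ^ 3 + q ^ 3) := by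
    intro p q hp hq; nlinarith [sq_nonneg (p - q), mul_nonneg hp hq]
  calc (a + b) ^ 6 = ((a + b) ^ 2) ^ 3 := by ring
    _ ≤ (2 * (a ^ 2 + b ^ 2)) ^ 3 := pow_le_pow_left₀ (by positivity) h1 3
    _ = 8 * (a ^ 2 + b ^ 2) ^ 3 := by ring
    _ ≤ 8 * (4 * ((a ^ 2) ^ 3 + (b ^ 2) ^ 3)) :=
        mul_le_mul_of_nonneg_left (h2 (sq_nonneg a) (sq_nonneg b)) (by norm_num)
    _ = 32 * (a ^ 6 + b ^ 6) := by ring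

/-- `(p + εq)³ ≤ p³ + ε (p + q)³` for `p, q ≥ 0`, `0 ≤ ε ≤ 1`. [folklore] -/
private theorem add_smul_pow_three_le' {p q ε : ℝ} (hp : 0 ≤ p) (hq : 0 ≤ q) (hε : 0 ≤ ε)
    (hε1 : ε ≤ 1) : (p + ε * q) ^ 3 ≤ p ^ 3 + ε * (p + q) ^ 3 := by
  have h2 : ε ^ 2 ≤ ε := by nlinarith
  have h3 : ε ^ 3 ≤ ε := by nlinarith
  have hA : 0 ≤ 3 * p * q ^ 2 := by positivity
  have hB : 0 ≤ q ^ 3 := by positivity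
  calc (p + ε * q) ^ 3
      = p ^ 3 + ε * (3 * p ^ 2 * q) + ε ^ 2 * (3 * p * q ^ 2) + ε ^ 3 * q ^ 3 := by ring
    _ ≤ p ^ 3 + ε * (3 * p ^ 2 * q) + ε * (3 * p * q ^ 2) + ε * q ^ 3 := by
        have e2 := mul_le_mul_of_nonneg_right h2 hA
        have e3 := mul_le_mul_of_nonneg_right h3 hB
        linarith
    _ = p ^ 3 + ε * (3 * p ^ 2 * q + 3 * p * q ^ 2 + q ^ 3) := by ring
    _ ≤ p ^ 3 + ε * (p + q) ^ 3 := by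
        have e : (p + q) ^ 3 = p ^ 3 + (3 * p ^ 2 * q + 3 * p * q ^ 2 + q ^ 3) := by ring
        have hle : 3 * p ^ 2 * q + 3 * p * q ^ 2 + q ^ 3 ≤ (p + q) ^ 3 := by
          rw [e]; linarith [pow_nonneg hp 3]
        have := mul_le_mul_of_nonneg_left hle hε
        linarith

/-- **`L¹⁸` by `I₆`.** Given a mean-zero Sobolev constant `C₆` (`∫‖v‖⁶ ≤ C₆ ‖∇v‖₂⁶`), for every
smooth zero-mean `u` on `T^d`,
`∫‖u‖¹⁸ ≤ 32 (729 C₆ + (39420 d³)³) (∫‖u‖⁴∑ₖ‖∂ₖu‖²)³`. [ours] -/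
theorem integral_norm_pow_eighteen_le {C₆ : ℝ} (hC₆0 : 0 ≤ C₆)
    (hC₆ : ∀ v : UnitAddTorus d → EuclideanSpace ℝ d, IsSmooth v → HasZeroMean v →
      ∫ x, ‖v x‖ ^ 6 ≤ C₆ * gradNormSq v ^ 3)
    {u : UnitAddTorus d → EuclideanSpace ℝ d} (hu : IsSmooth u) (h0 : HasZeroMean u) :
    ∫ x, ‖u x‖ ^ 18 ≤
      32 * (729 * C₆ + (39420 * (Fintype.card d : ℝ) ^ 3) ^ 3) *
        (∫ x, ‖u x‖ ^ 4 * ∑ k, ‖partialDeriv k u x‖ ^ 2) ^ 3 := by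
  obtain ⟨I, hI⟩ : ∃ I : ℝ, I = ∫ x, ‖u x‖ ^ 4 * ∑ k, ‖partialDeriv k u x‖ ^ 2 := ⟨_, rfl⟩
  obtain ⟨J, hJ⟩ : ∃ J : ℝ, J = ∫ x, ‖u x‖ ^ 2 * ∑ k, ‖partialDeriv k u x‖ ^ 2 := ⟨_, rfl⟩
  obtain ⟨U, hU⟩ : ∃ U : ℝ, U = ∫ x, ‖u x‖ ^ 6 := ⟨_, rfl⟩
  obtain ⟨U4, hU4⟩ : ∃ U : ℝ, U = ∫ x, ‖u x‖ ^ 4 := ⟨_, rfl⟩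
  obtain ⟨K, hK⟩ : ∃ K : ℝ, K = ∫ x, ‖u x‖ ^ 2 := ⟨_, rfl⟩
  obtain ⟨Z, hZ⟩ : ∃ Z : ℝ, Z = gradNormSq u := ⟨_, rfl⟩
  obtain ⟨CNP, hCNP⟩ : ∃ C : ℝ, C = 39420 * (Fintype.card d : ℝ) ^ 3 := ⟨_, rfl⟩
  rw [← hI, ← hCNP]
  have huc : Continuous u := hu.continuous
  have hcs : Continuous fun x => ∑ k, ‖partialDeriv k u x‖ ^ 2 :=
    continuous_finsetSum _ fun k _ => (hu.partialDeriv k).continuous.norm.pow 2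
  have hI0 : 0 ≤ I := by rw [hI]; exact integral_nonneg fun x => by positivity
  have hJ0 : 0 ≤ J := by rw [hJ]; exact integral_nonneg fun x => by positivity
  have hU0 : 0 ≤ U := by rw [hU]; exact integral_nonneg fun x => by positivity
  have hU40 : 0 ≤ U4 := by rw [hU4]; exact integral_nonneg fun x => by positivity
  have hK0 : 0 ≤ K := by rw [hK]; exact integral_nonneg fun x => by positivity
  have hZ0 : 0 ≤ Z := by rw [hZ]; exact gradNormSq_nonneg u
  have hNP : U ≤ CNP * I := by
    rw [hU, hCNP, hI]; exact integral_norm_pow_six_le_weighted hu h0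
  -- for every `0 < ε ≤ 1`
  have hε : ∀ ε : ℝ, 0 < ε → ε ≤ 1 →
      ∫ x, ‖u x‖ ^ 18 ≤
        32 * (729 * C₆ * (I + ε * (2 * J + Z)) ^ 3 + (U + ε * (2 * U4 + K)) ^ 3) := by
    intro ε hε hε1
    obtain ⟨Wε, hWε⟩ : ∃ W : UnitAddTorus d → EuclideanSpace ℝ d,
        W = fun x => (‖u x‖ ^ 2 + ε) • u x := ⟨_, rfl⟩
    obtain ⟨cε, hcε⟩ : ∃ c : EuclideanSpace ℝ d, c = ∫ x, Wε x := ⟨_, rfl⟩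
    have hWεs : IsSmooth Wε := by rw [hWε]; exact isSmooth_reg2 hu ε
    have hWεc : Continuous Wε := hWεs.continuous
    -- Sobolev for `Wε − cε`
    have hsm : IsSmooth (fun x => Wε x - cε) := hWεs.sub (isSmooth_const cε)
    have hzm : HasZeroMean (fun x => Wε x - cε) := by
      show ∫ x, (Wε x - cε) = 0
      rw [integral_sub hWεc.integrable_unitAddTorus (integrable_const _), integral_const, hcε]
      simp
    have hS := hC₆ _ hsm hzm
    have hg : gradNormSq (fun x => Wε x - cε) = gradNormSq Wε := by
      unfold gradNormSq
      refine integral_congr_ae (ae_of_all _ fun x => ?_)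
      refine Finset.sum_congr rfl fun k _ => ?_
      have e : (fun x => Wε x - cε) = Wε + fun _ => -cε := by
        funext y; simp [sub_eq_add_neg]
      have hcst : IsContDiff 1 (fun _ : UnitAddTorus d => -cε) := contDiff_const
      have hz : partialDeriv k (fun _ : UnitAddTorus d => -cε) x = 0 := by
        simp [Torus.partialDeriv, Torus.lineDeriv]
      rw [e, partialDeriv_add (hWεs.isContDiff (by simp)) hcst, Pi.add_apply, hz, add_zero]
    -- `gradNormSq Wε ≤ 9 (I + ε(2J + Z))`
    have hG : gradNormSq Wε ≤ 9 * (I + ε * (2 * J + Z)) := by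
      have h := gradNormSq_reg2_le hu hε.le
      rw [← hWε] at h
      have hpt : ∀ x, (‖u x‖ ^ 2 + ε) ^ 2 * ∑ k, ‖partialDeriv k u x‖ ^ 2 ≤
          ‖u x‖ ^ 4 * ∑ k, ‖partialDeriv k u x‖ ^ 2 +
            ε * (2 * (‖u x‖ ^ 2 * ∑ k, ‖partialDeriv k u x‖ ^ 2) +
              ∑ k, ‖partialDeriv k u x‖ ^ 2) := by
        intro x
        have hs : 0 ≤ ∑ k, ‖partialDeriv k u x‖ ^ 2 :=
          Finset.sum_nonneg fun k _ => sq_nonneg _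
        have hε2 : ε ^ 2 ≤ ε := by nlinarith
        have hexp : (‖u x‖ ^ 2 + ε) ^ 2 * ∑ k, ‖partialDeriv k u x‖ ^ 2 =
            ‖u x‖ ^ 4 * ∑ k, ‖partialDeriv k u x‖ ^ 2 +
              ε * (2 * (‖u x‖ ^ 2 * ∑ k, ‖partialDeriv k u x‖ ^ 2)) +
                ε ^ 2 * ∑ k, ‖partialDeriv k u x‖ ^ 2 := by ring
        have hm := mul_le_mul_of_nonneg_right hε2 hs
        rw [hexp]
        linarith
      have hi1 : Integrable (fun x => ‖u x‖ ^ 4 * ∑ k, ‖partialDeriv k u x‖ ^ 2) volume :=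
        ((huc.norm.pow 4).mul hcs).integrable_unitAddTorus
      have hi2 : Integrable (fun x => ‖u x‖ ^ 2 * ∑ k, ‖partialDeriv k u x‖ ^ 2) volume :=
        ((huc.norm.pow 2).mul hcs).integrable_unitAddTorus
      have hi3 : Integrable (fun x => ∑ k, ‖partialDeriv k u x‖ ^ 2) volume :=
        hcs.integrable_unitAddTorus
      have hi4 : Integrable (fun x => 2 * (‖u x‖ ^ 2 * ∑ k, ‖partialDeriv k u x‖ ^ 2) +
          ∑ k, ‖partialDeriv k u x‖ ^ 2) volume := (hi2.const_mul 2).add hi3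
      have hi5 : Integrable (fun x => ε * (2 * (‖u x‖ ^ 2 * ∑ k, ‖partialDeriv k u x‖ ^ 2) +
          ∑ k, ‖partialDeriv k u x‖ ^ 2)) volume := hi4.const_mul ε
      have hle : ∫ x, (‖u x‖ ^ 2 + ε) ^ 2 * ∑ k, ‖partialDeriv k u x‖ ^ 2 ≤
          I + ε * (2 * J + Z) := by
        calc ∫ x, (‖u x‖ ^ 2 + ε) ^ 2 * ∑ k, ‖partialDeriv k u x‖ ^ 2
            ≤ ∫ x, (‖u x‖ ^ 4 * ∑ k, ‖partialDeriv k u x‖ ^ 2 +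
                ε * (2 * (‖u x‖ ^ 2 * ∑ k, ‖partialDeriv k u x‖ ^ 2) +
                  ∑ k, ‖partialDeriv k u x‖ ^ 2)) :=
              integral_mono ((((huc.norm.pow 2).add continuous_const).pow 2).mul
                hcs).integrable_unitAddTorus (hi1.add hi5) hpt
          _ = I + ε * (2 * J + Z) := by
              rw [integral_add hi1 hi5, integral_const_mul, integral_add (hi2.const_mul 2) hi3,
                integral_const_mul, ← hI, ← hJ, hZ]
              rfl
      linarith
    have hG0 : 0 ≤ gradNormSq Wε := gradNormSq_nonneg _
    have h6 : ∫ x, ‖Wε x - cε‖ ^ 6 ≤ C₆ * (9 * (I + ε * (2 * J + Z))) ^ 3 := by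
      calc ∫ x, ‖Wε x - cε‖ ^ 6 ≤ C₆ * gradNormSq (fun x => Wε x - cε) ^ 3 := hS
        _ = C₆ * gradNormSq Wε ^ 3 := by rw [hg]
        _ ≤ C₆ * (9 * (I + ε * (2 * J + Z))) ^ 3 := by gcongr
    -- the mean: `‖cε‖² ≤ ∫‖Wε‖² ≤ U + ε(2U4 + K)`
    have hW2 : ∫ x, ‖Wε x‖ ^ 2 ≤ U + ε * (2 * U4 + K) := by
      have hpt : ∀ x, ‖Wε x‖ ^ 2 ≤ ‖u x‖ ^ 6 + ε * (2 * ‖u x‖ ^ 4 + ‖u x‖ ^ 2) := by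
        intro x
        simp only [hWε, norm_smul, Real.norm_of_nonneg (by positivity : (0 : ℝ) ≤ ‖u x‖ ^ 2 + ε)]
        have hε2 : ε ^ 2 ≤ ε := by nlinarith
        have h2 : 0 ≤ ‖u x‖ ^ 2 := sq_nonneg _
        have hexp : ((‖u x‖ ^ 2 + ε) * ‖u x‖) ^ 2 =
            ‖u x‖ ^ 6 + ε * (2 * ‖u x‖ ^ 4) + ε ^ 2 * ‖u x‖ ^ 2 := by ring
        rw [hexp]
        have := mul_le_mul_of_nonneg_right hε2 h2
        linarith
      have hi6 : Integrable (fun x => ‖u x‖ ^ 6) volume := (huc.norm.pow 6).integrable_unitAddTorus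
      have hi42 : Integrable (fun x => 2 * ‖u x‖ ^ 4 + ‖u x‖ ^ 2) volume :=
        (((huc.norm.pow 4).const_mul 2).add (huc.norm.pow 2)).integrable_unitAddTorus
      have hi7 : Integrable (fun x => ε * (2 * ‖u x‖ ^ 4 + ‖u x‖ ^ 2)) volume := hi42.const_mul ε
      calc ∫ x, ‖Wε x‖ ^ 2 ≤ ∫ x, (‖u x‖ ^ 6 + ε * (2 * ‖u x‖ ^ 4 + ‖u x‖ ^ 2)) :=
            integral_mono ((hWεc.norm.pow 2).integrable_unitAddTorus) (hi6.add hi7) hpt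
        _ = U + ε * (2 * U4 + K) := by
            have hi4' : Integrable (fun x => 2 * ‖u x‖ ^ 4) volume :=
              ((huc.norm.pow 4).integrable_unitAddTorus).const_mul 2
            have hi2' : Integrable (fun x => ‖u x‖ ^ 2) volume := (huc.norm.pow 2).integrable_unitAddTorus
            rw [integral_add hi6 hi7, integral_const_mul, integral_add hi4' hi2', integral_const_mul,
              ← hU, ← hU4, ← hK]
    have hc : ‖cε‖ ^ 2 ≤ U + ε * (2 * U4 + K) := by
      have h1 : ‖cε‖ ≤ ∫ x, ‖Wε x‖ := by rw [hcε]; exact norm_integral_le_integral_norm _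
      have h2 : ∫ x, ‖Wε x‖ ≤ Real.sqrt (∫ x, ‖Wε x‖ ^ 2) :=
        VelocityL4.integral_le_sqrt_integral_sq hWεc.norm
      have h3 : 0 ≤ ∫ x, ‖Wε x‖ ^ 2 := integral_nonneg fun x => sq_nonneg _
      calc ‖cε‖ ^ 2 ≤ (Real.sqrt (∫ x, ‖Wε x‖ ^ 2)) ^ 2 := pow_le_pow_left₀ (norm_nonneg _) (h1.trans h2) 2
        _ = ∫ x, ‖Wε x‖ ^ 2 := Real.sq_sqrt h3
        _ ≤ U + ε * (2 * U4 + K) := hW2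
    have hcK0 : 0 ≤ U + ε * (2 * U4 + K) := by positivity
    have hc6 : ‖cε‖ ^ 6 ≤ (U + ε * (2 * U4 + K)) ^ 3 := by
      calc ‖cε‖ ^ 6 = (‖cε‖ ^ 2) ^ 3 := by ring
        _ ≤ (U + ε * (2 * U4 + K)) ^ 3 := pow_le_pow_left₀ (sq_nonneg _) hc 3
    -- pointwise: `‖u‖¹⁸ ≤ ‖Wε‖⁶ ≤ 32 (‖Wε − cε‖⁶ + ‖cε‖⁶)`
    have hpt : ∀ x, ‖u x‖ ^ 18 ≤ 32 * ‖Wε x - cε‖ ^ 6 + 32 * ‖cε‖ ^ 6 := by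
      intro x
      have hnW : ‖Wε x‖ = (‖u x‖ ^ 2 + ε) * ‖u x‖ := by
        simp only [hWε, norm_smul, Real.norm_of_nonneg (by positivity : (0 : ℝ) ≤ ‖u x‖ ^ 2 + ε)]
      have h3 : ‖u x‖ ^ 3 ≤ ‖Wε x‖ := by
        rw [hnW]; nlinarith [norm_nonneg (u x), mul_nonneg hε.le (norm_nonneg (u x))]
      have h18 : ‖u x‖ ^ 18 ≤ ‖Wε x‖ ^ 6 := by
        calc ‖u x‖ ^ 18 = (‖u x‖ ^ 3) ^ 6 := by ring
          _ ≤ ‖Wε x‖ ^ 6 := pow_le_pow_left₀ (by positivity) h3 6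
      have htri : ‖Wε x‖ ≤ ‖Wε x - cε‖ + ‖cε‖ := by
        have := norm_add_le (Wε x - cε) cε; rwa [sub_add_cancel] at this
      have h6' : ‖Wε x‖ ^ 6 ≤ (‖Wε x - cε‖ + ‖cε‖) ^ 6 := pow_le_pow_left₀ (norm_nonneg _) htri 6
      have h32 := add_pow_six_le' ‖Wε x - cε‖ ‖cε‖
      linarith
    have hia : Integrable (fun x => 32 * ‖Wε x - cε‖ ^ 6) volume :=
      (((hWεc.sub continuous_const).norm.pow 6).const_mul 32).integrable_unitAddTorus
    calc ∫ x, ‖u x‖ ^ 18 ≤ ∫ x, (32 * ‖Wε x - cε‖ ^ 6 + 32 * ‖cε‖ ^ 6) :=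
          integral_mono ((huc.norm.pow 18).integrable_unitAddTorus) (hia.add (integrable_const _)) hpt
      _ = 32 * (∫ x, ‖Wε x - cε‖ ^ 6) + 32 * ‖cε‖ ^ 6 := by
          rw [integral_add hia (integrable_const _), integral_const_mul, integral_const]
          simp
      _ ≤ 32 * (C₆ * (9 * (I + ε * (2 * J + Z))) ^ 3) + 32 * (U + ε * (2 * U4 + K)) ^ 3 := by
          gcongr
      _ = 32 * (729 * C₆ * (I + ε * (2 * J + Z)) ^ 3 + (U + ε * (2 * U4 + K)) ^ 3) := by ring
  -- `ε → 0`
  have hmain : ∫ x, ‖u x‖ ^ 18 ≤ 32 * (729 * C₆ * I ^ 3 + U ^ 3) := by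
    refine le_of_forall_pos_lt_add fun η hη => ?_
    obtain ⟨B, hB⟩ : ∃ B : ℝ, B = 32 * (729 * C₆ * (I + (2 * J + Z)) ^ 3 + (U + (2 * U4 + K)) ^ 3) :=
      ⟨_, rfl⟩
    have hB0 : 0 ≤ B := by rw [hB]; positivity
    have hB1 : 0 < B + 1 := by linarith
    obtain ⟨ε, hεdef⟩ : ∃ ε : ℝ, ε = min 1 (η / (B + 1)) := ⟨_, rfl⟩
    have hε0 : 0 < ε := by rw [hεdef]; exact lt_min one_pos (div_pos hη hB1)
    have hε1 : ε ≤ 1 := by rw [hεdef]; exact min_le_left _ _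
    have hεη : ε * B < η := by
      have h1 : ε ≤ η / (B + 1) := by rw [hεdef]; exact min_le_right _ _
      have h2 : η / (B + 1) * B < η := by
        rw [div_mul_eq_mul_div, div_lt_iff₀ hB1]
        have : η * (B + 1) = η * B + η := by ring
        rw [this]; linarith
      calc ε * B ≤ η / (B + 1) * B := mul_le_mul_of_nonneg_right h1 hB0
        _ < η := h2
    have h := hε ε hε0 hε1
    have c1 := add_smul_pow_three_le' hI0 (by positivity : (0 : ℝ) ≤ 2 * J + Z) hε0.le hε1
    have c2 := add_smul_pow_three_le' hU0 (by positivity : (0 : ℝ) ≤ 2 * U4 + K) hε0.le hε1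
    have hC : 0 ≤ 729 * C₆ := by positivity
    have e1 : 729 * C₆ * (I + ε * (2 * J + Z)) ^ 3 ≤
        729 * C₆ * I ^ 3 + ε * (729 * C₆ * (I + (2 * J + Z)) ^ 3) := by
      have := mul_le_mul_of_nonneg_left c1 hC
      have e : 729 * C₆ * (I ^ 3 + ε * (I + (2 * J + Z)) ^ 3) =
          729 * C₆ * I ^ 3 + ε * (729 * C₆ * (I + (2 * J + Z)) ^ 3) := by ring
      linarith
    have eB : ε * B = 32 * (ε * (729 * C₆ * (I + (2 * J + Z)) ^ 3)) +
        32 * (ε * (U + (2 * U4 + K)) ^ 3) := by rw [hB]; ring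
    have step : 32 * (729 * C₆ * (I + ε * (2 * J + Z)) ^ 3 + (U + ε * (2 * U4 + K)) ^ 3) ≤
        32 * (729 * C₆ * I ^ 3 + U ^ 3) + ε * B := by
      rw [eB]; linarith
    linarith
  have hU3 : U ^ 3 ≤ CNP ^ 3 * I ^ 3 := by
    rw [← mul_pow]; exact pow_le_pow_left₀ hU0 hNP 3
  calc ∫ x, ‖u x‖ ^ 18 ≤ 32 * (729 * C₆ * I ^ 3 + U ^ 3) := hmain
    _ ≤ 32 * (729 * C₆ * I ^ 3 + CNP ^ 3 * I ^ 3) := by gcongr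
    _ = 32 * (729 * C₆ + CNP ^ 3) * I ^ 3 := by ring

end VelocityL6

end Summit.NavierStokesRegularity.FunctionalMining
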